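import Literature.AlgebraicGeometry.AbelianSchemes.AbelianSchemeLDeltaOfLambda
import Literature.AlgebraicGeometry.AbelianSchemes.PolarizedAbelianSchemeWithLevel
import HarnessLib

/-!
# `L^Δ(λ) = (1, λ)^*𝒫` commutes with base change: `G^* L^Δ(λ) ≅ L^Δ(λ′)` along a pull-back of polarised abelian schemes

Layer `Literature/AlgebraicGeometry/AbelianSchemes`, namespace `Literature.AlgebraicGeometry.AbelianSchemes`.
THEOREMS ONLY (no definition, no named fact, no instance, no `sorry`).  Cell `hodgecm-mathlib` (D-0151), node U-e
(N3-core), assembler leaf (A2)-alg: the fibre reading of the global class `[L^Δ(λ^univ)]` of the universal family at a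
classified triple `P′` (B-p03 (g14) socket (R) `Ue_N3asm_pairReading`).  HC_CM is proved only modulo the 7 printed citations
until rung 0 closes.

Setting ([MumfordFogartyKirwan1994, Ch. 6 §2 Prop. 6.10 (p. 121) and Ch. 7 §2 Definition 7.2 (p. 129)]): `A/S`, `A′/S′`
abelian schemes with dual pairs `D = (Â, 𝒫)`, `D′ = (Â′, 𝒫′)` (★ `DualPair`) and morphisms `λ : A → Â` over `S`,
`λ′ : A′ → Â′` over `S′`; a morphism `f : S′ → S` and maps `G : A′ → A`, `Ĝ : Â′ → Â` over `f` such that the Poincaré sheaf pulls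
back, `(G ×_f Ĝ)^*𝒫 ≅ 𝒫′`, and `λ′ ≫ Ĝ = G ≫ λ` — exactly the Poincaré clause and the `λ`-clause of the tree's relation
★ `PolarizedAbelianSchemeWithLevel.IsBaseChangeVia` («`𝒜_{g,d,n}` is a contravariant functor … in the obvious way»,
Def. 7.2: `(X, λ) ↦ (X ×_S T, λ_T)`).  The graphs `Gr = (1_A, λ) : A → A ×_S Â`, `Gr′ = (1_{A′}, λ′) : A′ → A′ ×_{S′} Â′` are
passed as morphisms with their two defining projections (the cell's «map as a variable» convention of ★
`AbelianSchemeLDeltaOfLambda`), and `L^Δ(λ) := Gr^*𝒫` ([MumfordFogartyKirwan1994] Prop. 6.10: «`L^Δ(λ) = (1_X, λ)^*(𝓛)`»).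

* §1 `graph_comp_pullbackMap` — `Gr′ ≫ (G ×_f Ĝ) = G ≫ Gr` (both components agree: `1 ≫ G = G ≫ 1`, `λ′ ≫ Ĝ = G ≫ λ`);
  `nonempty_iso_pullback_LDelta` — the MODULE isomorphism `G^*(Gr^*𝒫) ≅ Gr′^*𝒫′` (Mathlib `Scheme.Modules.pullbackComp`
  twice and `Gr′^*` of the Poincaré clause); **`detClass_LDelta_eq_pullback`** — in `Ȟ¹(A′, 𝒪^×)`:
  `[Gr′^*𝒫′] = G^*[Gr^*𝒫]` (★ `detClass_pullback`, ★ `detClass_eq_of_iso`), i.e. «`L^Δ(λ_T) = L^Δ(λ)_T`».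
* §2 the same for the tree's triples: `PolarizedAbelianSchemeWithLevel.IsBaseChangeVia.nonempty_iso_pullback_LDelta` /
  `….detClass_LDelta_eq_pullback` (destructure the relation).
* §3 restriction to a fibre: for any `j′ : Y → A′` (e.g. the fibre inclusion `ι_{s′}` of `A′`),
  `[j′^*Gr′^*𝒫′] = (j′ ≫ G)^*[Gr^*𝒫]` (`detClass_restrict_LDelta_eq_pullback`), and the junction with ★ T1
  `phiPic_detClass_restrict_LDelta` at a geometric point `s′` of `S′` where `λ′` is `Λ(𝒪(Θ))`:
  **`phiPic_pullback_detClass_LDelta_of_isBaseChangeVia`** — `φ_{(ι_{s′} ≫ G)^*[L^Δ(λ)]}(x) = φ_Θ(x)²` on `A′_{s′}(Ω)`: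
  the class of the SOURCE family's `L^Δ(λ)` read on a fibre of the classified triple is twice the polarisation there
  ([MumfordFogartyKirwan1994] Prop. 6.10 «`Λ(L^Δ(λ)) = 2λ`», through Def. 7.2's pull-back).

## References
* [MumfordFogartyKirwan1994] D. Mumford, J. Fogarty, F. Kirwan, *Geometric Invariant Theory* (3rd ed., 1994), Ch. 6 §2
  Prop. 6.10 (p. 121); Ch. 7 §2 Definition 7.2 (p. 129).
* [Hartshorne1977] R. Hartshorne, *Algebraic Geometry* (1977), II Ex. 6.8 (functoriality of `Pic`).
-/

noncomputable section

open CategoryTheory CategoryTheory.Limits AlgebraicGeometry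

universe u

namespace Literature.AlgebraicGeometry.AbelianSchemes

open Literature.AlgebraicGeometry.Motives Literature.AlgebraicGeometry.Modules
  Literature.AlgebraicGeometry.AbelianVarieties

namespace AbelianSchemeOver

/-- `(f ≫ g)^* = f^* ∘ g^*` on `Ȟ¹(-, 𝒪^×)` (through ★ `detClass_pullback` and Mathlib `Scheme.Modules.pullbackComp`; private
copy of the tree's `CechPic.pullback_comp`, as in ★ `AbelianSchemeLDeltaOfLambda`). [cite: Hartshorne1977, II Ex. 6.8 (a)] -/
private theorem cechPic_pullback_comp'' {X Y Z : Scheme.{u}} (f : X ⟶ Y) (g : Y ⟶ Z) (c₀ : CechPic Z) :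
    CechPic.pullback (f ≫ g) c₀ = CechPic.pullback f (CechPic.pullback g c₀) := by
  obtain ⟨c, rfl⟩ := CechPic.mk_surjective c₀
  have hE := c.isFiniteLocallyFree_lineBundle
  rw [← c.detClass_lineBundle, ← detClass_pullback, ← detClass_pullback, ← detClass_pullback]
  exact detClass_eq_of_iso ((Scheme.Modules.pullbackComp f g).app (lineBundle c)).symm _ _

variable {S S' : Scheme.{u}} (A : AbelianSchemeOver S) (D : A.DualPair) (lam : A.X ⟶ D.hat.X)
  (A' : AbelianSchemeOver S') (D' : A'.DualPair) (lam' : A'.X ⟶ D'.hat.X)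
  (f : S' ⟶ S) (G : A'.X.left ⟶ A.X.left) (Ĝ : D'.hat.X.left ⟶ D.hat.X.left)
  (wG : A'.X.hom ≫ f = G ≫ A.X.hom) (wĜ : D'.hat.X.hom ≫ f = Ĝ ≫ D.hat.X.hom)
  (Gr : A.X.left ⟶ A.prodLeft D.hat) (hGr₁ : Gr ≫ pullback.fst A.X.hom D.hat.X.hom = 𝟙 _)
  (hGr₂ : Gr ≫ pullback.snd A.X.hom D.hat.X.hom = lam.left)
  (Gr' : A'.X.left ⟶ A'.prodLeft D'.hat) (hGr'₁ : Gr' ≫ pullback.fst A'.X.hom D'.hat.X.hom = 𝟙 _)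
  (hGr'₂ : Gr' ≫ pullback.snd A'.X.hom D'.hat.X.hom = lam'.left)

/-! ### §1 `Gr′ ≫ (G ×_f Ĝ) = G ≫ Gr` and `G^* L^Δ(λ) ≅ L^Δ(λ′)` -/

section Generic

include hGr₁ hGr₂ hGr'₁ hGr'₂ in
/-- **The graphs commute with the base-change maps**: `(1_{A′}, λ′) ≫ (G ×_f Ĝ) = G ≫ (1_A, λ)` as morphisms
`A′ → A ×_S Â` (first components `G = G`, second components `λ′ ≫ Ĝ = G ≫ λ`).
[cite: MumfordFogartyKirwan1994, Ch. 7 §2 Definition 7.2 (p. 129)] -/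
theorem graph_comp_pullbackMap (hlam : lam'.left ≫ Ĝ = G ≫ lam.left) :
    Gr' ≫ pullback.map A'.X.hom D'.hat.X.hom A.X.hom D.hat.X.hom G Ĝ f wG wĜ = G ≫ Gr := by
  apply pullback.hom_ext
  · rw [Category.assoc, pullback.lift_fst, ← Category.assoc, hGr'₁, Category.id_comp, Category.assoc, hGr₁,
      Category.comp_id]
  · rw [Category.assoc, pullback.lift_snd, ← Category.assoc, hGr'₂, hlam, Category.assoc, hGr₂]

include hGr₁ hGr₂ hGr'₁ hGr'₂ in
/-- **`G^* L^Δ(λ) ≅ L^Δ(λ′)` as modules on `A′`**: from the Poincaré clause `(G ×_f Ĝ)^*𝒫 ≅ 𝒫′` and `λ′ ≫ Ĝ = G ≫ λ`,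
`G^*((1, λ)^*𝒫) ≅ (G ≫ (1, λ))^*𝒫 = ((1, λ′) ≫ (G ×_f Ĝ))^*𝒫 ≅ (1, λ′)^*((G ×_f Ĝ)^*𝒫) ≅ (1, λ′)^*𝒫′` — «`L^Δ(λ_T)` is
`L^Δ(λ)` pulled back» ([MumfordFogartyKirwan1994] Def. 7.2 `(X, λ) ↦ (X ×_S T, λ_T)` applied to Prop. 6.10's `L^Δ`).
[cite: MumfordFogartyKirwan1994, Ch. 6 §2 Prop. 6.10 (p. 121)] [cite: MumfordFogartyKirwan1994, Ch. 7 §2 Definition 7.2 (p. 129)] -/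
theorem nonempty_iso_pullback_LDelta (hlam : lam'.left ≫ Ĝ = G ≫ lam.left)
    (e : (Scheme.Modules.pullback (pullback.map A'.X.hom D'.hat.X.hom A.X.hom D.hat.X.hom G Ĝ f wG wĜ)).obj D.P ≅ D'.P) :
    Nonempty ((Scheme.Modules.pullback G).obj ((Scheme.Modules.pullback Gr).obj D.P) ≅
      (Scheme.Modules.pullback Gr').obj D'.P) := by
  have hcomp := A.graph_comp_pullbackMap D lam A' D' lam' f G Ĝ wG wĜ Gr hGr₁ hGr₂ Gr' hGr'₁ hGr'₂ hlam
  exact ⟨(Scheme.Modules.pullbackComp G Gr).app D.P ≪≫ (Scheme.Modules.pullbackCongr hcomp.symm).app D.P ≪≫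
    ((Scheme.Modules.pullbackComp Gr' _).app D.P).symm ≪≫ (Scheme.Modules.pullback Gr').mapIso e⟩

include hGr₁ hGr₂ hGr'₁ hGr'₂ in
/-- **`[L^Δ(λ′)] = G^*[L^Δ(λ)]` in `Ȟ¹(A′, 𝒪^×)`** (determinant classes; ★ `detClass_pullback`, ★ `detClass_eq_of_iso`; any
local-freeness witnesses). [cite: MumfordFogartyKirwan1994, Ch. 6 §2 Prop. 6.10 (p. 121)]
[cite: MumfordFogartyKirwan1994, Ch. 7 §2 Definition 7.2 (p. 129)] [cite: Hartshorne1977, II Ex. 6.8] -/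
theorem detClass_LDelta_eq_pullback (hlam : lam'.left ≫ Ĝ = G ≫ lam.left)
    (e : (Scheme.Modules.pullback (pullback.map A'.X.hom D'.hat.X.hom A.X.hom D.hat.X.hom G Ĝ f wG wĜ)).obj D.P ≅ D'.P)
    (hL : IsFiniteLocallyFree ((Scheme.Modules.pullback Gr).obj D.P))
    (hL' : IsFiniteLocallyFree ((Scheme.Modules.pullback Gr').obj D'.P)) :
    detClass hL' = CechPic.pullback G (detClass hL) := by
  obtain ⟨i⟩ := A.nonempty_iso_pullback_LDelta D lam A' D' lam' f G Ĝ wG wĜ Gr hGr₁ hGr₂ Gr' hGr'₁ hGr'₂ hlam e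
  rw [← detClass_pullback G hL]
  exact detClass_eq_of_iso i.symm hL' (hL.pullback G)

end Generic

/-! ### §3 Restriction to a fibre of `A′` and the junction with Prop. 6.10 at a geometric point -/

section Fibre

include hGr₁ hGr₂ hGr'₁ hGr'₂ in
/-- **Restricted to any `j′ : Y → A′`**: `[j′^* L^Δ(λ′)] = (j′ ≫ G)^*[L^Δ(λ)]` in `Ȟ¹(Y, 𝒪^×)` (e.g. `j′ = ι_{s′}` a fibre
inclusion of `A′`). [cite: MumfordFogartyKirwan1994, Ch. 6 §2 Prop. 6.10 (p. 121)] [cite: Hartshorne1977, II Ex. 6.8] -/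
theorem detClass_restrict_LDelta_eq_pullback (hlam : lam'.left ≫ Ĝ = G ≫ lam.left)
    (e : (Scheme.Modules.pullback (pullback.map A'.X.hom D'.hat.X.hom A.X.hom D.hat.X.hom G Ĝ f wG wĜ)).obj D.P ≅ D'.P)
    (hL : IsFiniteLocallyFree ((Scheme.Modules.pullback Gr).obj D.P)) {Y : Scheme.{u}} (j' : Y ⟶ A'.X.left)
    (hLj : IsFiniteLocallyFree ((Scheme.Modules.pullback j').obj ((Scheme.Modules.pullback Gr').obj D'.P))) :
    detClass hLj = CechPic.pullback (j' ≫ G) (detClass hL) := by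
  have hL' : IsFiniteLocallyFree ((Scheme.Modules.pullback Gr').obj D'.P) :=
    (HasRank.isFiniteLocallyFree' D'.hasRank_one).pullback Gr'
  rw [cechPic_pullback_comp'', ← A.detClass_LDelta_eq_pullback D lam A' D' lam' f G Ĝ wG wĜ Gr hGr₁ hGr₂ Gr' hGr'₁ hGr'₂
    hlam e hL hL', ← detClass_pullback j' hL']

variable {Ω : Type u} [Field Ω] [IsAlgClosed Ω] (s' : Spec (.of Ω) ⟶ S')
  {j' : (A'.fibre s').toAbelianVariety.X.left ⟶ A'.X.left} {Θ : CartierDivisor (A'.fibre s').toAbelianVariety.X.left}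

include hGr₁ hGr₂ hGr'₁ hGr'₂ in
/-- **[MumfordFogartyKirwan1994, Prop. 6.10] READ THROUGH A PULL-BACK (Def. 7.2).**  If `(A′, λ′)` over `S′` is the
pull-back of `(A, λ)` over `S` via `(G, Ĝ)` (Poincaré clause `e`, `λ′ ≫ Ĝ = G ≫ λ`), `s′ : Spec Ω → S′` is a geometric
point (`Ω` algebraically closed), `j′ = ι_{s′}` the fibre inclusion of `A′` and `Θ` a Cartier divisor on `A′_{s′}` with
`λ̄′ = Λ(𝒪(Θ))` at `s′` (★ `IsLambdaOfAt`), then the class of the SOURCE `L^Δ(λ) = (1, λ)^*𝒫` pulled back along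
`ι_{s′} ≫ G : A′_{s′} → A` satisfies `φ_{(ι_{s′} ≫ G)^*[L^Δ(λ)]}(x) = φ_Θ(x)²` for every `x ∈ A′_{s′}(Ω)` — `Λ(L^Δ(λ)) = 2λ`
on the fibre of the classified object. [cite: MumfordFogartyKirwan1994, Ch. 6 §2 Prop. 6.10 (p. 121)]
[cite: MumfordFogartyKirwan1994, Ch. 7 §2 Definition 7.2 (p. 129)] -/
theorem phiPic_pullback_detClass_LDelta_of_isBaseChangeVia (hlam : lam'.left ≫ Ĝ = G ≫ lam.left)
    (e : (Scheme.Modules.pullback (pullback.map A'.X.hom D'.hat.X.hom A.X.hom D.hat.X.hom G Ĝ f wG wĜ)).obj D.P ≅ D'.P)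
    (hL : IsFiniteLocallyFree ((Scheme.Modules.pullback Gr).obj D.P))
    (hι : j' = pullback.fst A'.X.hom s') (hΛ : A'.IsLambdaOfAt s' D' lam' Θ)
    (x : (A'.fibre s').toAbelianVariety.Points Ω) :
    phiPic (A'.fibre s').toAbelianVariety (CechPic.pullback (j' ≫ G) (detClass hL)) x =
      phiPic (A'.fibre s').toAbelianVariety Θ.cechClass x ^ 2 := by
  have hLj : IsFiniteLocallyFree ((Scheme.Modules.pullback j').obj ((Scheme.Modules.pullback Gr').obj D'.P)) :=
    ((HasRank.isFiniteLocallyFree' D'.hasRank_one).pullback Gr').pullback j'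
  rw [← A.detClass_restrict_LDelta_eq_pullback D lam A' D' lam' f G Ĝ wG wĜ Gr hGr₁ hGr₂ Gr' hGr'₁ hGr'₂ hlam e hL j' hLj]
  exact A'.phiPic_detClass_restrict_LDelta D' s' hι hΛ Gr' hGr'₁ hGr'₂ hLj x

end Fibre

end AbelianSchemeOver

/-! ### §2 For the tree's triples `PolarizedAbelianSchemeWithLevel` and the relation `IsBaseChangeVia` -/

namespace PolarizedAbelianSchemeWithLevel

variable {g N : ℕ} {δ : Fin g → ℕ} {S T : Scheme.{u}} {P' : PolarizedAbelianSchemeWithLevel g N δ T}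
  {P : PolarizedAbelianSchemeWithLevel g N δ S} {f : T ⟶ S} {G : P'.A.X.left ⟶ P.A.X.left}
  {Ĝ : P'.D.hat.X.left ⟶ P.D.hat.X.left}
  (Gr : P.A.X.left ⟶ P.A.prodLeft P.D.hat) (hGr₁ : Gr ≫ pullback.fst P.A.X.hom P.D.hat.X.hom = 𝟙 _)
  (hGr₂ : Gr ≫ pullback.snd P.A.X.hom P.D.hat.X.hom = P.pol.lam.left)
  (Gr' : P'.A.X.left ⟶ P'.A.prodLeft P'.D.hat) (hGr'₁ : Gr' ≫ pullback.fst P'.A.X.hom P'.D.hat.X.hom = 𝟙 _)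
  (hGr'₂ : Gr' ≫ pullback.snd P'.A.X.hom P'.D.hat.X.hom = P'.pol.lam.left)

include hGr₁ hGr₂ hGr'₁ hGr'₂ in
/-- **`G^* L^Δ(λ) ≅ L^Δ(λ′)` for a pull-back of triples** (`IsBaseChangeVia`: its Poincaré clause and `λ′ ≫ Ĝ = G ≫ λ`).
[cite: MumfordFogartyKirwan1994, Ch. 7 §2 Definition 7.2 (p. 129)] [cite: MumfordFogartyKirwan1994, Ch. 6 §2 Prop. 6.10 (p. 121)] -/
theorem IsBaseChangeVia.nonempty_iso_pullback_LDelta (h : P'.IsBaseChangeVia P f G Ĝ) :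
    Nonempty ((Scheme.Modules.pullback G).obj ((Scheme.Modules.pullback Gr).obj P.D.P) ≅
      (Scheme.Modules.pullback Gr').obj P'.D.P) := by
  obtain ⟨-, -, ⟨wG, wĜ, ⟨e⟩⟩, hlam⟩ := h
  exact P.A.nonempty_iso_pullback_LDelta P.D P.pol.lam P'.A P'.D P'.pol.lam f G Ĝ wG wĜ Gr hGr₁ hGr₂ Gr' hGr'₁ hGr'₂
    hlam e

include hGr₁ hGr₂ hGr'₁ hGr'₂ in
/-- **`[L^Δ(λ′)] = G^*[L^Δ(λ)]` in `Ȟ¹(X′, 𝒪^×)` for a pull-back of triples.**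
[cite: MumfordFogartyKirwan1994, Ch. 7 §2 Definition 7.2 (p. 129)] [cite: MumfordFogartyKirwan1994, Ch. 6 §2 Prop. 6.10 (p. 121)] -/
theorem IsBaseChangeVia.detClass_LDelta_eq_pullback (h : P'.IsBaseChangeVia P f G Ĝ)
    (hL : IsFiniteLocallyFree ((Scheme.Modules.pullback Gr).obj P.D.P))
    (hL' : IsFiniteLocallyFree ((Scheme.Modules.pullback Gr').obj P'.D.P)) :
    detClass hL' = CechPic.pullback G (detClass hL) := by
  obtain ⟨-, -, ⟨wG, wĜ, ⟨e⟩⟩, hlam⟩ := h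
  exact P.A.detClass_LDelta_eq_pullback P.D P.pol.lam P'.A P'.D P'.pol.lam f G Ĝ wG wĜ Gr hGr₁ hGr₂ Gr' hGr'₁ hGr'₂
    hlam e hL hL'

include hGr₁ hGr₂ hGr'₁ hGr'₂ in
/-- **Restricted to any `j′ : Y → X′`** (e.g. the fibre inclusion `pullback.fst P′.A.X.hom s′`):
`[j′^* L^Δ(λ′)] = (j′ ≫ G)^*[L^Δ(λ)]`. [cite: MumfordFogartyKirwan1994, Ch. 7 §2 Definition 7.2 (p. 129)]
[cite: MumfordFogartyKirwan1994, Ch. 6 §2 Prop. 6.10 (p. 121)] -/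
theorem IsBaseChangeVia.detClass_restrict_LDelta_eq_pullback (h : P'.IsBaseChangeVia P f G Ĝ)
    (hL : IsFiniteLocallyFree ((Scheme.Modules.pullback Gr).obj P.D.P)) {Y : Scheme.{u}} (j' : Y ⟶ P'.A.X.left)
    (hLj : IsFiniteLocallyFree ((Scheme.Modules.pullback j').obj ((Scheme.Modules.pullback Gr').obj P'.D.P))) :
    detClass hLj = CechPic.pullback (j' ≫ G) (detClass hL) := by
  obtain ⟨-, -, ⟨wG, wĜ, ⟨e⟩⟩, hlam⟩ := h
  exact P.A.detClass_restrict_LDelta_eq_pullback P.D P.pol.lam P'.A P'.D P'.pol.lam f G Ĝ wG wĜ Gr hGr₁ hGr₂ Gr' hGr'₁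
    hGr'₂ hlam e hL j' hLj

include hGr₁ hGr₂ in
/-- **Prop. 6.10 on a fibre of the classified triple, from the polarisation of `P′` alone**: at every geometric point `s′` of
`T` there is an AMPLE `Θ` on `X′_{s′}` with `φ_{(ι_{s′} ≫ G)^*[L^Δ(λ)]} = φ_Θ²` on `X′_{s′}(Ω)` (★ `Polarization.exists_ample`
for `P′.pol`; the graph of `λ′` is produced internally as `pullback.lift (𝟙 _) λ′`).
[cite: MumfordFogartyKirwan1994, Ch. 6 §2 Prop. 6.10 (p. 121)] [cite: MumfordFogartyKirwan1994, Ch. 7 §2 Definition 7.2 (p. 129)] -/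
theorem IsBaseChangeVia.exists_isAmple_phiPic_pullback_detClass_LDelta (h : P'.IsBaseChangeVia P f G Ĝ)
    (hL : IsFiniteLocallyFree ((Scheme.Modules.pullback Gr).obj P.D.P))
    {Ω : Type u} [Field Ω] [IsAlgClosed Ω] (s' : Spec (.of Ω) ⟶ T)
    {j' : (P'.A.fibre s').toAbelianVariety.X.left ⟶ P'.A.X.left} (hι : j' = pullback.fst P'.A.X.hom s') :
    ∃ Θ : CartierDivisor (P'.A.fibre s').toAbelianVariety.X.left, Θ.IsAmple ∧
      ∀ x : (P'.A.fibre s').toAbelianVariety.Points Ω,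
        phiPic (P'.A.fibre s').toAbelianVariety (CechPic.pullback (j' ≫ G) (detClass hL)) x =
          phiPic (P'.A.fibre s').toAbelianVariety Θ.cechClass x ^ 2 := by
  obtain ⟨-, -, ⟨wG, wĜ, ⟨e⟩⟩, hlam⟩ := h
  obtain ⟨Θ, hΘ, hΛ⟩ := P'.pol.exists_ample Ω s'
  refine ⟨Θ, hΘ, fun x => ?_⟩
  exact P.A.phiPic_pullback_detClass_LDelta_of_isBaseChangeVia P.D P.pol.lam P'.A P'.D P'.pol.lam f G Ĝ wG wĜ Gr hGr₁ hGr₂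
    (pullback.lift (𝟙 _) P'.pol.lam.left (by rw [Category.id_comp]; exact (Over.w P'.pol.lam).symm))
    (pullback.lift_fst _ _ _) (pullback.lift_snd _ _ _) s' hlam e hL hι hΛ x

include hGr₁ hGr₂ in
/-- **Prop. 6.10 on a fibre of the classified triple, for a GIVEN `Θ` with `λ̄′ = Λ(𝒪(Θ))` at `s′`** (★ `IsLambdaOfAt` for
`P′.A`, `P′.D`, `P′.pol.lam`): `φ_{(ι_{s′} ≫ G)^*[L^Δ(λ)]}(x) = φ_Θ(x)²` on `X′_{s′}(Ω)` — the consumer shape of the (N3-core)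
socket (R), whose fibre datum is `(Θ y, hlam y)` (the graph of `λ′` is produced internally as `pullback.lift (𝟙 _) λ′`).
[cite: MumfordFogartyKirwan1994, Ch. 6 §2 Prop. 6.10 (p. 121)] [cite: MumfordFogartyKirwan1994, Ch. 7 §2 Definition 7.2 (p. 129)] -/
theorem IsBaseChangeVia.phiPic_pullback_detClass_LDelta (h : P'.IsBaseChangeVia P f G Ĝ)
    (hL : IsFiniteLocallyFree ((Scheme.Modules.pullback Gr).obj P.D.P))
    {Ω : Type u} [Field Ω] [IsAlgClosed Ω] (s' : Spec (.of Ω) ⟶ T)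
    {j' : (P'.A.fibre s').toAbelianVariety.X.left ⟶ P'.A.X.left} (hι : j' = pullback.fst P'.A.X.hom s')
    {Θ : CartierDivisor (P'.A.fibre s').toAbelianVariety.X.left} (hΛ : P'.A.IsLambdaOfAt s' P'.D P'.pol.lam Θ)
    (x : (P'.A.fibre s').toAbelianVariety.Points Ω) :
    phiPic (P'.A.fibre s').toAbelianVariety (CechPic.pullback (j' ≫ G) (detClass hL)) x =
      phiPic (P'.A.fibre s').toAbelianVariety Θ.cechClass x ^ 2 := by
  obtain ⟨-, -, ⟨wG, wĜ, ⟨e⟩⟩, hlam⟩ := h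
  exact P.A.phiPic_pullback_detClass_LDelta_of_isBaseChangeVia P.D P.pol.lam P'.A P'.D P'.pol.lam f G Ĝ wG wĜ Gr hGr₁ hGr₂
    (pullback.lift (𝟙 _) P'.pol.lam.left (by rw [Category.id_comp]; exact (Over.w P'.pol.lam).symm))
    (pullback.lift_fst _ _ _) (pullback.lift_snd _ _ _) s' hlam e hL hι hΛ x

end PolarizedAbelianSchemeWithLevel

end Literature.AlgebraicGeometry.AbelianSchemes
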